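import Mathlib
import Summits.ResolutionOfSingularities.ResolutionOfSingularities.Theorems.WildQuotientsWildQuotientResolutionToricExitWeightZero
import Summits.ResolutionOfSingularities.ResolutionOfSingularities.Theorems.WildQuotientsWildQuotientResolutionJordanFourParity
import Summits.ResolutionOfSingularities.ResolutionOfSingularities.Theorems.WildQuotientsWildQuotientResolutionFixedPointsGraded
import Summits.ResolutionOfSingularities.ResolutionOfSingularities.Theorems.WildQuotientsWildQuotientResolutionJordanFiveMu2CoverDefs
import Summits.ResolutionOfSingularities.ResolutionOfSingularities.Theorems.WildQuotientsWildQuotientResolutionJordanFiveMu2CoverAction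
import Summits.ResolutionOfSingularities.ResolutionOfSingularities.Theorems.WildQuotientsWildQuotientResolutionJordanFiveMu2CoverActionExists
import Summits.ResolutionOfSingularities.ResolutionOfSingularities.Theorems.WildQuotientsWildQuotientResolutionJordanFiveMu2CoverDescent

/-!
# RUNG V5 (`J₅`), brick B7/HP₂ — the generators lemma: `τ_U`-invariants of the twisted-root cover

(crux stmt-ResolutionOfSingularities-15640 `WildQuotients.WildQuotientResolution`, line `Sketch`,
sector `|G| = p`; RUNG V5 of `L/w45c/CHAIN.md` v8.5, brick B7/`HP₂`; res-L1-w45c-plan-1 ORDER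
2026-08-27T14:26:36Z / RULING 14:29:53Z «`hgens` (= the generators lemma) has ONE owner: stub-3»;
statement = res-type-036 14:03:53Z «`U₂^{τU} = Algebra.adjoin k (π '' {Y₀,Y₂,Y₄, s², sY₁, sY₃, Y₁²,
Y₁Y₃, Y₃², passengers} ∪ {1/î})`», in the `≤` form consumed as the hypothesis `hgens` of
res-L1-w45c-stub-5's (W₂-A) `JordanFive.exists_chartW₂_away_ringEquiv_fixedTau`.
[OURS · L1 W4.5c] — NOT a statement of any manuscript; replaces the role of no printed item.
Prover res-L1-w45c-stub-3.)

* GENERIC PARITY (any finite index type `σ`, three distinct ODD indices `o₁ o₂ o₃`, field `k`):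
  the even subalgebra `adjoin k ({X o₁², X o₁X o₂, X o₁X o₃, X o₂², X o₂X o₃, X o₃²} ∪ {X i : i ∉ {o₁,o₂,o₃}})`
  is the degree-`0` part of the parity grading (`mem_adjoin_evenGens₃_iff`), and contains every
  fixed point of the sign involution when `2 ≠ 0` (`mem_adjoin_evenGens₃_of_deck_eq`) — the
  `J₄` file `…JordanFourParity` (res-L1-w45c-stub-1) verbatim with `Fin n` generalised to `σ`.
* **`JordanFive.fixedPoints_coverTau_le_adjoin`** — on ANY localisation `U` of `k[s, Y, pass] ⧸ I`
  away from `î` (`IsLocalization.Away`), for ANY `k`-automorphism `τ_U` with the deck laws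
  `π s, π Y_b, π Y_d ↦ −π s, −π Y_b, −π Y_d`, other variables fixed (`2 ≠ 0` in `k`):
  `U^{⟨τ_U⟩} ≤ adjoin k (π '' ({X (some i) : i ∉ {b,d}} ∪ {s², sY_b, sY_d, Y_b², Y_bY_d, Y_d²}) ∪ {1/î})`
  — Reynolds `½(F + τ_A F)` on `u = π F · î⁻ᵐ` (`τ_U ∘ π = π ∘ τ_A`, `cover_apply_algebraMap_mk`;
  `τ_A î = î`, `coverTau_apply_coverIHat`), then the generic parity lemma.
-/

-- single-problem summit: the doubled namespace component `ResolutionOfSingularities` is forced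
set_option linter.dupNamespace false

noncomputable section

open MvPolynomial

namespace Summit.ResolutionOfSingularities.ResolutionOfSingularities.Theorems.WildQuotientResolution.JordanFive

section EvenSubalgebraThree

/-! ### Generic parity: three odd variables on an arbitrary finite index type -/

variable (k : Type) [Field k] {σ : Type} [Fintype σ] [DecidableEq σ] (o₁ o₂ o₃ : σ)
  (h12 : o₁ ≠ o₂) (h13 : o₁ ≠ o₃) (h23 : o₂ ≠ o₃)
  (w : σ → ZMod 2) (hw1 : w o₁ = 1) (hw2 : w o₂ = 1) (hw3 : w o₃ = 1)
  (hw0 : ∀ i, i ≠ o₁ → i ≠ o₂ → i ≠ o₃ → w i = 0)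

omit [Fintype σ] [DecidableEq σ] in
include hw1 hw2 hw3 hw0 in
/-- The even generators `{X o₁², X o₁X o₂, X o₁X o₃, X o₂², X o₂X o₃, X o₃²} ∪ {X i : i ∉ {o₁,o₂,o₃}}`
are homogeneous of degree `0` for the parity weight. [folklore] -/
theorem isWeightedHomogeneous_zero_of_mem_evenGens₃ (g : MvPolynomial σ k)
    (hg : g ∈ ({X o₁ ^ 2, X o₁ * X o₂, X o₁ * X o₃, X o₂ ^ 2, X o₂ * X o₃, X o₃ ^ 2} :
        Set (MvPolynomial σ k)) ∪ ((fun i => X i) '' {i | i ≠ o₁ ∧ i ≠ o₂ ∧ i ≠ o₃})) :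
    IsWeightedHomogeneous w g 0 := by
  have e11 : (1 : ZMod 2) + 1 = 0 := by decide
  have hX : ∀ i, w i = 1 → IsWeightedHomogeneous w (X i : MvPolynomial σ k) 1 := by
    intro i hi
    have h := isWeightedHomogeneous_X k w i
    rwa [hi] at h
  have hXX : ∀ i j, w i = 1 → w j = 1 →
      IsWeightedHomogeneous w (X i * X j : MvPolynomial σ k) 0 := by
    intro i j hi hj
    have h := (hX i hi).mul (hX j hj)
    rwa [e11] at h
  have hsq : ∀ i, w i = 1 → IsWeightedHomogeneous w (X i ^ 2 : MvPolynomial σ k) 0 := by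
    intro i hi
    rw [sq]
    exact hXX i i hi hi
  rcases hg with hg | ⟨i, ⟨hi1, hi2, hi3⟩, rfl⟩
  · simp only [Set.mem_insert_iff, Set.mem_singleton_iff] at hg
    rcases hg with rfl | rfl | rfl | rfl | rfl | rfl
    · exact hsq o₁ hw1
    · exact hXX o₁ o₂ hw1 hw2
    · exact hXX o₁ o₃ hw1 hw3
    · exact hsq o₂ hw2
    · exact hXX o₂ o₃ hw2 hw3
    · exact hsq o₃ hw3
  · have h := isWeightedHomogeneous_X k w i
    rwa [hw0 i hi1 hi2 hi3] at h

include h12 h13 h23 hw1 hw2 hw3 hw0 in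
/-- The parity weight of an exponent vector is the parity of `d o₁ + d o₂ + d o₃`. [folklore] -/
theorem weight_eq_three₃ (d : σ →₀ ℕ) :
    Finsupp.weight w d = ((d o₁ + d o₂ + d o₃ : ℕ) : ZMod 2) := by
  classical
  rw [Finsupp.weight_apply, Finsupp.sum_fintype _ _ (fun i => by simp)]
  have h2' : o₂ ∈ Finset.univ.erase o₁ :=
    Finset.mem_erase.mpr ⟨fun h => h12 h.symm, Finset.mem_univ o₂⟩
  have h3' : o₃ ∈ (Finset.univ.erase o₁).erase o₂ :=
    Finset.mem_erase.mpr ⟨fun h => h23 h.symm, Finset.mem_erase.mpr ⟨fun h => h13 h.symm,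
      Finset.mem_univ o₃⟩⟩
  rw [← Finset.add_sum_erase _ _ (Finset.mem_univ o₁), ← Finset.add_sum_erase _ _ h2',
    ← Finset.add_sum_erase _ _ h3', Finset.sum_eq_zero]
  · rw [hw1, hw2, hw3, Nat.smul_one_eq_cast, Nat.smul_one_eq_cast, Nat.smul_one_eq_cast]
    push_cast
    ring
  · intro i hi
    obtain ⟨hi3, hi'⟩ := Finset.mem_erase.mp hi
    obtain ⟨hi2, hi''⟩ := Finset.mem_erase.mp hi'
    obtain ⟨hi1, -⟩ := Finset.mem_erase.mp hi''
    rw [hw0 i hi1 hi2 hi3, smul_zero]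

omit [Fintype σ] [DecidableEq σ] in
/-- `X o₁^i X o₂^j X o₃^l` with `i + j + l` even lies in the even subalgebra. [folklore] -/
theorem pow_mul_pow_mul_pow_mem_adjoin_evenGens₃ (i j l : ℕ) (h : Even (i + j + l)) :
    (X o₁ ^ i * X o₂ ^ j * X o₃ ^ l : MvPolynomial σ k) ∈ Algebra.adjoin k
      (({X o₁ ^ 2, X o₁ * X o₂, X o₁ * X o₃, X o₂ ^ 2, X o₂ * X o₃, X o₃ ^ 2} :
        Set (MvPolynomial σ k)) ∪ ((fun i => X i) '' {i | i ≠ o₁ ∧ i ≠ o₂ ∧ i ≠ o₃})) := by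
  set E := Algebra.adjoin k
      (({X o₁ ^ 2, X o₁ * X o₂, X o₁ * X o₃, X o₂ ^ 2, X o₂ * X o₃, X o₃ ^ 2} :
        Set (MvPolynomial σ k)) ∪ ((fun i => X i) '' {i | i ≠ o₁ ∧ i ≠ o₂ ∧ i ≠ o₃})) with hE
  have haa : (X o₁ ^ 2 : MvPolynomial σ k) ∈ E := Algebra.subset_adjoin (Or.inl (by simp))
  have hab' : (X o₁ * X o₂ : MvPolynomial σ k) ∈ E := Algebra.subset_adjoin (Or.inl (by simp))
  have hac' : (X o₁ * X o₃ : MvPolynomial σ k) ∈ E := Algebra.subset_adjoin (Or.inl (by simp))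
  have hbb : (X o₂ ^ 2 : MvPolynomial σ k) ∈ E := Algebra.subset_adjoin (Or.inl (by simp))
  have hbc' : (X o₂ * X o₃ : MvPolynomial σ k) ∈ E := Algebra.subset_adjoin (Or.inl (by simp))
  have hcc : (X o₃ ^ 2 : MvPolynomial σ k) ∈ E := Algebra.subset_adjoin (Or.inl (by simp))
  rcases Nat.even_or_odd i with ⟨i', hi⟩ | ⟨i', hi⟩ <;>
    rcases Nat.even_or_odd j with ⟨j', hj⟩ | ⟨j', hj⟩ <;>
      rcases Nat.even_or_odd l with ⟨l', hl⟩ | ⟨l', hl⟩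
  · -- (even, even, even)
    have e : (X o₁ ^ i * X o₂ ^ j * X o₃ ^ l : MvPolynomial σ k) =
        (X o₁ ^ 2) ^ i' * (X o₂ ^ 2) ^ j' * (X o₃ ^ 2) ^ l' := by rw [hi, hj, hl]; ring
    rw [e]
    exact E.mul_mem (E.mul_mem (E.pow_mem haa _) (E.pow_mem hbb _)) (E.pow_mem hcc _)
  · exfalso; rw [hi, hj, hl] at h
    exact Nat.not_even_iff_odd.mpr ⟨i' + j' + l', by ring⟩ h
  · exfalso; rw [hi, hj, hl] at h
    exact Nat.not_even_iff_odd.mpr ⟨i' + j' + l', by ring⟩ h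
  · -- (even, odd, odd)
    have e : (X o₁ ^ i * X o₂ ^ j * X o₃ ^ l : MvPolynomial σ k) =
        (X o₁ ^ 2) ^ i' * (X o₂ ^ 2) ^ j' * (X o₃ ^ 2) ^ l' * (X o₂ * X o₃) := by
      rw [hi, hj, hl]; ring
    rw [e]
    exact E.mul_mem (E.mul_mem (E.mul_mem (E.pow_mem haa _) (E.pow_mem hbb _)) (E.pow_mem hcc _))
      hbc'
  · exfalso; rw [hi, hj, hl] at h
    exact Nat.not_even_iff_odd.mpr ⟨i' + j' + l', by ring⟩ h
  · -- (odd, even, odd)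
    have e : (X o₁ ^ i * X o₂ ^ j * X o₃ ^ l : MvPolynomial σ k) =
        (X o₁ ^ 2) ^ i' * (X o₂ ^ 2) ^ j' * (X o₃ ^ 2) ^ l' * (X o₁ * X o₃) := by
      rw [hi, hj, hl]; ring
    rw [e]
    exact E.mul_mem (E.mul_mem (E.mul_mem (E.pow_mem haa _) (E.pow_mem hbb _)) (E.pow_mem hcc _))
      hac'
  · -- (odd, odd, even)
    have e : (X o₁ ^ i * X o₂ ^ j * X o₃ ^ l : MvPolynomial σ k) =
        (X o₁ ^ 2) ^ i' * (X o₂ ^ 2) ^ j' * (X o₃ ^ 2) ^ l' * (X o₁ * X o₂) := by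
      rw [hi, hj, hl]; ring
    rw [e]
    exact E.mul_mem (E.mul_mem (E.mul_mem (E.pow_mem haa _) (E.pow_mem hbb _)) (E.pow_mem hcc _))
      hab'
  · exfalso; rw [hi, hj, hl] at h
    exact Nat.not_even_iff_odd.mpr ⟨i' + j' + l' + 1, by ring⟩ h

include h12 h13 h23 hw1 hw2 hw3 hw0 in
/-- **Every even monomial lies in the even subalgebra.** [folklore] -/
theorem monomial_mem_adjoin_evenGens₃ (d : σ →₀ ℕ) (hd : Finsupp.weight w d = 0) :
    (monomial d (1 : k)) ∈ Algebra.adjoin k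
      (({X o₁ ^ 2, X o₁ * X o₂, X o₁ * X o₃, X o₂ ^ 2, X o₂ * X o₃, X o₃ ^ 2} :
        Set (MvPolynomial σ k)) ∪ ((fun i => X i) '' {i | i ≠ o₁ ∧ i ≠ o₂ ∧ i ≠ o₃})) := by
  classical
  set E := Algebra.adjoin k
      (({X o₁ ^ 2, X o₁ * X o₂, X o₁ * X o₃, X o₂ ^ 2, X o₂ * X o₃, X o₃ ^ 2} :
        Set (MvPolynomial σ k)) ∪ ((fun i => X i) '' {i | i ≠ o₁ ∧ i ≠ o₂ ∧ i ≠ o₃})) with hE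
  have heven : Even (d o₁ + d o₂ + d o₃) := by
    rw [weight_eq_three₃ o₁ o₂ o₃ h12 h13 h23 w hw1 hw2 hw3 hw0] at hd
    exact (ZMod.natCast_eq_zero_iff_even).mp hd
  rw [monomial_eq, C_1, one_mul, Finsupp.prod_fintype _ _ (fun i => pow_zero _)]
  have h2' : o₂ ∈ Finset.univ.erase o₁ :=
    Finset.mem_erase.mpr ⟨fun h => h12 h.symm, Finset.mem_univ o₂⟩
  have h3' : o₃ ∈ (Finset.univ.erase o₁).erase o₂ :=
    Finset.mem_erase.mpr ⟨fun h => h23 h.symm, Finset.mem_erase.mpr ⟨fun h => h13 h.symm,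
      Finset.mem_univ o₃⟩⟩
  rw [← Finset.mul_prod_erase _ _ (Finset.mem_univ o₁), ← Finset.mul_prod_erase _ _ h2',
    ← Finset.mul_prod_erase _ _ h3', ← mul_assoc, ← mul_assoc]
  refine E.mul_mem (pow_mul_pow_mul_pow_mem_adjoin_evenGens₃ k o₁ o₂ o₃ _ _ _ heven)
    (Subalgebra.prod_mem _ fun i hi => ?_)
  obtain ⟨hi3, hi'⟩ := Finset.mem_erase.mp hi
  obtain ⟨hi2, hi''⟩ := Finset.mem_erase.mp hi'
  obtain ⟨hi1, -⟩ := Finset.mem_erase.mp hi''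
  exact E.pow_mem (Algebra.subset_adjoin (Or.inr ⟨i, ⟨hi1, hi2, hi3⟩, rfl⟩)) _

include h12 h13 h23 hw1 hw2 hw3 hw0 in
/-- **The even subalgebra is the degree-`0` part of the parity grading.** [folklore] -/
theorem mem_adjoin_evenGens₃_iff (f : MvPolynomial σ k) :
    f ∈ Algebra.adjoin k
      (({X o₁ ^ 2, X o₁ * X o₂, X o₁ * X o₃, X o₂ ^ 2, X o₂ * X o₃, X o₃ ^ 2} :
        Set (MvPolynomial σ k)) ∪ ((fun i => X i) '' {i | i ≠ o₁ ∧ i ≠ o₂ ∧ i ≠ o₃})) ↔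
      IsWeightedHomogeneous w f 0 :=
  ToricExit.mem_adjoin_iff_isWeightedHomogeneous_zero w _
    (isWeightedHomogeneous_zero_of_mem_evenGens₃ k o₁ o₂ o₃ w hw1 hw2 hw3 hw0)
    (monomial_mem_adjoin_evenGens₃ k o₁ o₂ o₃ h12 h13 h23 w hw1 hw2 hw3 hw0) f

include h12 h13 h23 in
/-- **Fixed points of the sign involution lie in the even subalgebra** (`2 ≠ 0` in `k`): if a
`k`-algebra endomorphism `ι` with `ι (X oⱼ) = −X oⱼ` (`j = 1,2,3`), `ι (X i) = X i` otherwise,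
fixes `f`, then `f ∈ adjoin k ({X o₁², …, X o₃²} ∪ {X i : i ∉ {o₁,o₂,o₃}})`. [folklore] -/
theorem mem_adjoin_evenGens₃_of_deck_eq (h2 : (2 : k) ≠ 0)
    (ι : MvPolynomial σ k →ₐ[k] MvPolynomial σ k)
    (hι1 : ι (X o₁) = -X o₁) (hι2 : ι (X o₂) = -X o₂) (hι3 : ι (X o₃) = -X o₃)
    (hι : ∀ i, i ≠ o₁ → i ≠ o₂ → i ≠ o₃ → ι (X i) = X i)
    (f : MvPolynomial σ k) (hf : ι f = f) :
    f ∈ Algebra.adjoin k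
      (({X o₁ ^ 2, X o₁ * X o₂, X o₁ * X o₃, X o₂ ^ 2, X o₂ * X o₃, X o₃ ^ 2} :
        Set (MvPolynomial σ k)) ∪ ((fun i => X i) '' {i | i ≠ o₁ ∧ i ≠ o₂ ∧ i ≠ o₃})) := by
  classical
  let w : σ → ZMod 2 := fun i => if i = o₁ ∨ i = o₂ ∨ i = o₃ then 1 else 0
  have hw1 : w o₁ = 1 := if_pos (Or.inl rfl)
  have hw2 : w o₂ = 1 := if_pos (Or.inr (Or.inl rfl))
  have hw3 : w o₃ = 1 := if_pos (Or.inr (Or.inr rfl))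
  have hw0 : ∀ i, i ≠ o₁ → i ≠ o₂ → i ≠ o₃ → w i = 0 :=
    fun i hi1 hi2 hi3 => if_neg (not_or.mpr ⟨hi1, not_or.mpr ⟨hi2, hi3⟩⟩)
  -- `ι` is the sign involution of `w`
  have hι' : ι = aeval (fun i => if w i = 0 then (X i : MvPolynomial σ k) else -X i) := by
    refine MvPolynomial.algHom_ext fun i => ?_
    rw [aeval_X]
    by_cases hi1 : i = o₁
    · subst hi1; rw [hι1, if_neg (by rw [hw1]; decide)]
    by_cases hi2 : i = o₂
    · subst hi2; rw [hι2, if_neg (by rw [hw2]; decide)]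
    by_cases hi3 : i = o₃
    · subst hi3; rw [hι3, if_neg (by rw [hw3]; decide)]
    rw [hι i hi1 hi2 hi3, if_pos (hw0 i hi1 hi2 hi3)]
  have h2' : (2 : k) ∈ nonZeroDivisors k := mem_nonZeroDivisors_of_ne_zero h2
  rw [hι'] at hf
  exact (mem_adjoin_evenGens₃_iff k o₁ o₂ o₃ h12 h13 h23 w hw1 hw2 hw3 hw0 f).mpr
    (JordanFour.isWeightedHomogeneous_zero_of_signAeval_eq w h2' f hf)

end EvenSubalgebraThree

/-! ### The generators lemma for the deck involution of the twisted-root cover -/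

section Cover

variable (k : Type) [Field k] (n : ℕ) (a b c d e : Fin n)
  (hab : a ≠ b) (had : a ≠ d) (hbc : b ≠ c) (hbd : b ≠ d) (hcd : c ≠ d) (hbe : b ≠ e)
  (hde : d ≠ e) (h2 : (2 : k) ≠ 0)
  (I : Ideal (MvPolynomial (Option (Fin n)) k)) (ι : MvPolynomial (Option (Fin n)) k)
  (hι : ι = coverIHat (X none) (X (some a)) (X (some b)) (X (some c)) (X (some d)) (X (some e)))
  (U : Type) [CommRing U] [Algebra (MvPolynomial (Option (Fin n)) k ⧸ I) U]
  [IsLocalization.Away (Ideal.Quotient.mk I ι) U] [Algebra k U]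
  [IsScalarTower k (MvPolynomial (Option (Fin n)) k ⧸ I) U]

include hab had hbc hbd hcd hbe hde h2 hι in
/-- **The generators lemma (`hgens`).** On any localisation `U` of `k[s, Y, pass] ⧸ I` away from
`î`, for any `k`-automorphism `τ_U` with the deck laws `π s ↦ −π s`, `π Y_b ↦ −π Y_b`,
`π Y_d ↦ −π Y_d`, all other variables fixed (`2 ≠ 0` in `k`), every `τ_U`-invariant lies in the
`k`-subalgebra generated by the images of the `τ`-even variables `X (some i)` (`i ∉ {b, d}`), of
the six even quadratics `s², sY_b, sY_d, Y_b², Y_bY_d, Y_d²`, and `1/î`: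
`U^{⟨τ_U⟩} ≤ adjoin k (π '' (…) ∪ {î⁻¹})`. Proof: `u = π F · î⁻ᵐ` (`IsLocalization.surj`),
`τ_U ∘ π = π ∘ τ_A` (`cover_apply_algebraMap_mk`, `exists_coverTau`), `τ_U î⁻¹ = î⁻¹`
(`coverTau_apply_coverIHat`), Reynolds `2u = π(F + τ_A F) · î⁻ᵐ`, and the parity lemma
`mem_adjoin_evenGens₃_of_deck_eq`. [OURS · L1 W4.5c; res-type-036 14:03:53Z statement,
res-L1-w45c-stub-5 `hgens`] -/
theorem fixedPoints_coverTau_le_adjoin (τU : U ≃ₐ[k] U)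
    (hτs : τU (algebraMap _ U (Ideal.Quotient.mk I (X none))) =
      -algebraMap _ U (Ideal.Quotient.mk I (X none)))
    (hτb : τU (algebraMap _ U (Ideal.Quotient.mk I (X (some b)))) =
      -algebraMap _ U (Ideal.Quotient.mk I (X (some b))))
    (hτd : τU (algebraMap _ U (Ideal.Quotient.mk I (X (some d)))) =
      -algebraMap _ U (Ideal.Quotient.mk I (X (some d))))
    (hτi : ∀ i, i ≠ b → i ≠ d → τU (algebraMap _ U (Ideal.Quotient.mk I (X (some i)))) =
      algebraMap _ U (Ideal.Quotient.mk I (X (some i)))) :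
    FixedPoints.subalgebra k U (Subgroup.zpowers τU) ≤
      Algebra.adjoin k
        ((fun x : MvPolynomial (Option (Fin n)) k => algebraMap _ U (Ideal.Quotient.mk I x)) ''
            ({x | ∃ i : Fin n, i ≠ b ∧ i ≠ d ∧ x = X (some i)} ∪
              {X none ^ 2, X none * X (some b), X none * X (some d), X (some b) ^ 2,
                X (some b) * X (some d), X (some d) ^ 2}) ∪
          {IsLocalization.Away.invSelf (Ideal.Quotient.mk I ι)}) := by
  classical
  -- abbreviations (`let`, never `set`: the instance binders mention `ι`)
  let G : Set (MvPolynomial (Option (Fin n)) k) :=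
    {x | ∃ i : Fin n, i ≠ b ∧ i ≠ d ∧ x = X (some i)} ∪
      {X none ^ 2, X none * X (some b), X none * X (some d), X (some b) ^ 2,
        X (some b) * X (some d), X (some d) ^ 2}
  let v : U := IsLocalization.Away.invSelf (S := U) (Ideal.Quotient.mk I ι)
  let πₐ : MvPolynomial (Option (Fin n)) k →ₐ[k] U :=
    (IsScalarTower.toAlgHom k (MvPolynomial (Option (Fin n)) k ⧸ I) U).comp (Ideal.Quotient.mkₐ k I)
  have hπₐ : (πₐ : MvPolynomial (Option (Fin n)) k → U) =
      fun x => algebraMap _ U (Ideal.Quotient.mk I x) := rfl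
  let V : Subalgebra k U := Algebra.adjoin k
    ((fun x : MvPolynomial (Option (Fin n)) k => algebraMap _ U (Ideal.Quotient.mk I x)) '' G ∪ {v})
  -- the polynomial-level deck involution and `τ_U ∘ π = π ∘ τ_A`
  obtain ⟨τA, τs, τ1, τ3, hτ, hττ⟩ := exists_coverTau k n b d
  have hlaws : ∀ o, τU (algebraMap _ U (Ideal.Quotient.mk I (X o))) =
      algebraMap _ U (Ideal.Quotient.mk I (τA (X o))) := by
    rintro (_ | i)
    · rw [hτs, τs, map_neg, map_neg]
    · by_cases hib : i = b
      · subst hib; rw [hτb, τ1, map_neg, map_neg]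
      by_cases hid : i = d
      · subst hid; rw [hτd, τ3, map_neg, map_neg]
      rw [hτi i hib hid, hτ i hib hid]
  have hτπ : ∀ x, τU (algebraMap _ U (Ideal.Quotient.mk I x)) =
      algebraMap _ U (Ideal.Quotient.mk I (τA x)) :=
    cover_apply_algebraMap_mk k n I U τU τA hlaws
  -- `τ_U` fixes `π î` and hence `î⁻¹`
  have hτι : τA ι = ι := by
    rw [hι]; exact coverTau_apply_coverIHat k n a b c d e hab had τA τs τ1 τ3 hτ hbc hcd hbe hde
  have hτUι : τU (algebraMap _ U (Ideal.Quotient.mk I ι)) =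
      algebraMap _ U (Ideal.Quotient.mk I ι) := by
    rw [hτπ, hτι]
  have hmulv : algebraMap _ U (Ideal.Quotient.mk I ι) * v = 1 :=
    IsLocalization.Away.mul_invSelf _
  have hτv : τU v = v := by
    calc τU v = τU v * (algebraMap _ U (Ideal.Quotient.mk I ι) * v) := by rw [hmulv, mul_one]
      _ = τU (v * algebraMap _ U (Ideal.Quotient.mk I ι)) * v := by
          rw [map_mul, hτUι, mul_assoc]
      _ = v := by rw [mul_comm v, hmulv, map_one, one_mul]
  -- `τ_A`-fixed polynomials map into `V`
  have hVG : ∀ F : MvPolynomial (Option (Fin n)) k, τA F = F →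
      algebraMap _ U (Ideal.Quotient.mk I F) ∈ V := by
    intro F hF
    have hmem : F ∈ Algebra.adjoin k
        (({X none ^ 2, X none * X (some b), X none * X (some d), X (some b) ^ 2,
            X (some b) * X (some d), X (some d) ^ 2} : Set (MvPolynomial (Option (Fin n)) k)) ∪
          ((fun o => X o) '' {o | o ≠ none ∧ o ≠ some b ∧ o ≠ some d})) :=
      mem_adjoin_evenGens₃_of_deck_eq k none (some b) (some d) (Option.some_ne_none b).symm
        (Option.some_ne_none d).symm (fun h => hbd (Option.some_inj.mp h)) h2
        (τA : MvPolynomial (Option (Fin n)) k →ₐ[k] MvPolynomial (Option (Fin n)) k) τs τ1 τ3 (by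
          rintro (_ | i) h1 hib hid
          · exact absurd rfl h1
          · exact hτ i (fun h => hib (by rw [h])) (fun h => hid (by rw [h]))) F hF
    have hsub : (({X none ^ 2, X none * X (some b), X none * X (some d), X (some b) ^ 2,
            X (some b) * X (some d), X (some d) ^ 2} : Set (MvPolynomial (Option (Fin n)) k)) ∪
          ((fun o => X o) '' {o | o ≠ none ∧ o ≠ some b ∧ o ≠ some d})) ⊆ G := by
      rintro x (hx | ⟨o, ⟨ho, hob, hod⟩, rfl⟩)
      · exact Or.inr hx
      · obtain ⟨i, rfl⟩ := Option.ne_none_iff_exists'.mp ho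
        exact Or.inl ⟨i, fun h => hob (by rw [h]), fun h => hod (by rw [h]), rfl⟩
    have h1 : πₐ F ∈ (Algebra.adjoin k G).map πₐ :=
      Subalgebra.mem_map.mpr ⟨F, Algebra.adjoin_mono hsub hmem, rfl⟩
    rw [AlgHom.map_adjoin, hπₐ] at h1
    exact Algebra.adjoin_mono Set.subset_union_left h1
  -- the Reynolds argument
  intro u hu
  rw [TameTransfer.mem_fixedPoints_zpowers_iff_apply_eq] at hu
  obtain ⟨⟨x, m⟩, hxm⟩ := IsLocalization.surj (Submonoid.powers (Ideal.Quotient.mk I ι)) u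
  obtain ⟨j, hj⟩ := m.2
  obtain ⟨x, rfl⟩ := Ideal.Quotient.mk_surjective x
  have hinv : algebraMap _ U (m : MvPolynomial (Option (Fin n)) k ⧸ I) * v ^ j = 1 := by
    rw [← hj, map_pow, ← mul_pow, hmulv, one_pow]
  have hux : u = algebraMap _ U (Ideal.Quotient.mk I x) * v ^ j := by
    calc u = u * (algebraMap _ U (m : MvPolynomial (Option (Fin n)) k ⧸ I) * v ^ j) := by
          rw [hinv, mul_one]
      _ = u * algebraMap _ U (m : MvPolynomial (Option (Fin n)) k ⧸ I) * v ^ j := by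
          rw [mul_assoc]
      _ = _ := by rw [hxm]
  have h2u : (2 : U) * u = algebraMap _ U (Ideal.Quotient.mk I (x + τA x)) * v ^ j := by
    have e1 : τU u = algebraMap _ U (Ideal.Quotient.mk I (τA x)) * v ^ j := by
      rw [hux, map_mul, map_pow, hτv, hτπ]
    calc (2 : U) * u = u + τU u := by rw [two_mul, hu]
      _ = _ := by rw [e1, hux, ← add_mul, ← map_add, ← map_add]
  have heven : τA (x + τA x) = x + τA x := by rw [map_add, hττ, add_comm]
  have h2uV : (2 : U) * u ∈ V :=
    h2u ▸ V.mul_mem (hVG _ heven) (V.pow_mem (Algebra.subset_adjoin (Or.inr rfl)) j)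
  have h2U : (2 : U) = algebraMap k U 2 := by rw [map_ofNat]
  have hu' : u = (2 : k)⁻¹ • ((2 : U) * u) := by
    rw [h2U, Algebra.smul_def, ← mul_assoc, ← map_mul, inv_mul_cancel₀ h2, map_one, one_mul]
  rw [hu']
  exact V.smul_mem h2uV _

end Cover

end Summit.ResolutionOfSingularities.ResolutionOfSingularities.Theorems.WildQuotientResolution.JordanFive

end
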